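import Summits.MatrixMultiplication.OmegaCensus.STPPCell22Stage1F

/-!
# ω-census (abelian STPP census): cell-(2,2) certificate of the fifth leaf `{(2,2,2),(3,3,3)²} @ ℤ₆₁` — stage 1 rows, file 103/136

HONEST FRAMING (pub-omega census; verbatim): lottery ticket; floor = certified bounds/negative ranges.
Census STRUCTURE (seat pub-omega-stpp-1 gen 33, 2026-08-29), family (b2).  KERNEL rows (`decide +kernel`) / glue for the checkers of
`STPPCell22Checker.lean`; design and python ×1 DATUM in HOME `pub-omega-stpp-1-g33/FIFTH-LEAF.md`, generator `code/gen_cell22_rows.py`.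
Nothing here is progress on `ω`.
-/

namespace Summit.MatrixMultiplication.OmegaCensus.CubeNB.S2

open Summit.MatrixMultiplication.OmegaCensus.CubeNB.Bits

/-- Stage-1 row: shape #203 `(2, 17177772047)` dilated by `w ∈ [1, 60]` against all 269 shapes. [folklore] -/
theorem c22s1_203_1_60 : ((List.range' 1 60).all (stage1F (2, 17177772047))) = true := by decide +kernel

/-- Stage-1 row: shape #204 `(2, 17178820615)` dilated by `w ∈ [1, 60]` against all 269 shapes. [folklore] -/
theorem c22s1_204_1_60 : ((List.range' 1 60).all (stage1F (2, 17178820615))) = true := by decide +kernel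


end Summit.MatrixMultiplication.OmegaCensus.CubeNB.S2
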